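import Literature.NumberTheory.Automorphic.GlobalWhittakerCoefficient
import HarnessLib

/-!
# The global Whittaker coefficient is invariant under rational central translations

Topic `NumberTheory/Automorphic`; namespace `Literature.NumberTheory.Automorphic`. Proof file
(theorems only). For `φ : GL_n(𝔸_K) → ℂ` left `GL_n(K)`-invariant and a rational scalar `c ∈ Kˣ`,
the global `ψ`-Whittaker coefficient (`whittakerCoeff`, Cogdell (2004), §1.1) satisfies
`W_φ(c g) = W_φ(g)`: the scalar matrix `c · 1` is central and rational, so
`φ(u c g) = φ(c u g) = φ(u g)` under the integral. In the real-point Rankin–Selberg programme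
(`RankinSelbergTorusPositivity`) this moves the torus base point `diag(a) k` with `W_φ ≠ 0` to
`diag(c a) k`, making its last coordinate integral at all finite places
(`exists_ne_zero_valued_algebraMap_mul_le_one`) without changing `W_φ`.

* `glDiagonal_const_mul_comm` — scalar matrices of units are central in `GL_n(R)`;
* `toAdelic_glDiagonal` — the diagonal embedding of a rational diagonal matrix is the adelic
  diagonal matrix of the principal ideles of its entries;
* `whittakerCoeff_glDiagonal_const_mul` (**main**) — `W_φ(diag(c, …, c) g) = W_φ(g)` for `c ∈ Kˣ`.

Everything is proved; folklore.

## References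

* J. W. Cogdell, *Analytic theory of L-functions for GL_n*, in *An Introduction to the Langlands
  Program* (2004), §1.1 [CogdellAnalyticTheory2004].
-/

noncomputable section

open MeasureTheory Measure NumberField IsDedekindDomain
open scoped MatrixGroups

namespace Literature.NumberTheory.Automorphic

section Central

variable {n : ℕ}

/-- Scalar matrices of units are central in `GL_n(R)`. [folklore] -/
theorem glDiagonal_const_mul_comm {R : Type*} [CommRing R] (c : Rˣ) (g : GL (Fin n) R) :
    glDiagonal n R (fun _ => c) * g = g * glDiagonal n R (fun _ => c) := by
  refine Units.ext ?_
  rw [Units.val_mul, Units.val_mul, coe_glDiagonal, ← Matrix.smul_one_eq_diagonal, Matrix.smul_mul,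
    Matrix.mul_smul, Matrix.one_mul, Matrix.mul_one]

variable {K : Type} [Field K] [NumberField K]

/-- The diagonal embedding `GL_n(K) → GL_n(𝔸_K)` of a diagonal matrix of rational units is the
diagonal matrix of the corresponding principal ideles. [folklore] -/
theorem toAdelic_glDiagonal (d : Fin n → Kˣ) :
    (AdelicGroupData.gl n K).toAdelic (glDiagonal n K d) =
      glDiagonal n (AdeleRing (𝓞 K) K) fun i =>
        Units.map (algebraMap K (AdeleRing (𝓞 K) K) : K →* AdeleRing (𝓞 K) K) (d i) := by
  refine Units.ext ?_
  change (algebraMap K (AdeleRing (𝓞 K) K)).mapMatrix (glDiagonal n K d : Matrix (Fin n) (Fin n) K) = _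
  rw [coe_glDiagonal, coe_glDiagonal, RingHom.mapMatrix_apply, Matrix.diagonal_map (map_zero _)]
  rfl

variable [MeasurableSpace ↥(adelicUnipotent n K)]

/-- **`W_φ(c g) = W_φ(g)` for rational scalars.** For `φ` left `GL_n(K)`-invariant
(`IsLeftInvariant`), every measure `ν`, domain `𝓕` and character `ψ`, and every `c ∈ Kˣ`, the global
Whittaker coefficient is unchanged by the central translation `diag(c, …, c)` (principal ideles of
`c` on the diagonal). [folklore] -/
theorem whittakerCoeff_glDiagonal_const_mul (ν : Measure ↥(adelicUnipotent n K))
    (𝓕 : Set ↥(adelicUnipotent n K)) (ψ : AddChar (AdeleRing (𝓞 K) K) Circle)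
    {φ : GL (Fin n) (AdeleRing (𝓞 K) K) → ℂ} (hφ : IsLeftInvariant (AdelicGroupData.gl n K) φ)
    (c : Kˣ) (g : GL (Fin n) (AdeleRing (𝓞 K) K)) :
    whittakerCoeff ν 𝓕 ψ φ
        (glDiagonal n (AdeleRing (𝓞 K) K)
          (fun _ => Units.map (algebraMap K (AdeleRing (𝓞 K) K) : K →* AdeleRing (𝓞 K) K) c) * g) =
      whittakerCoeff ν 𝓕 ψ φ g := by
  set z : GL (Fin n) (AdeleRing (𝓞 K) K) := glDiagonal n (AdeleRing (𝓞 K) K)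
    (fun _ => Units.map (algebraMap K (AdeleRing (𝓞 K) K) : K →* AdeleRing (𝓞 K) K) c) with hz
  have hzK : z = (AdelicGroupData.gl n K).toAdelic (glDiagonal n K fun _ => c) := by
    rw [hz, toAdelic_glDiagonal]
  have hcomm : ∀ u : GL (Fin n) (AdeleRing (𝓞 K) K), u * z = z * u := fun u =>
    (glDiagonal_const_mul_comm _ u).symm
  have h : ∀ u : ↥(adelicUnipotent n K),
      φ ((u : GL (Fin n) (AdeleRing (𝓞 K) K)) * (z * g)) = φ ((u : GL (Fin n) (AdeleRing (𝓞 K) K)) * g) := by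
    intro u
    rw [← mul_assoc, hcomm, mul_assoc, hzK]
    exact hφ _ ⟨_, rfl⟩ _
  simp_rw [whittakerCoeff_def, h]

end Central

end Literature.NumberTheory.Automorphic
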